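import Mathlib
import Summits.NavierStokesRegularity.NavierStokesRegularity.Theorems.FilamentSkeletonRssAnalyticStripLiaSymbolNumericsDefs

/-!
# Clause 13-J/13-R, brick B5 (BAND WINDOW, certified numerics) — DEFINITIONS: the cell checker `cellOKDer`/`cellsOKDer` for `Φ′ = 2C − E ≥ φ₀`
# and its `p`-grid

Route `FilamentSkeletonRss`, ∃-side clause 13 (`Clause13RNearStraightL` stmt-NavierStokesRegularity-23612; typing-agnostic); design
`filament-plan/DESIGN-28296-model-gluing-g16.md` §4 n1b.  Statement-only file (definitions; no theorem), companion of
`…AnalyticStripLiaSymbolNumericsDefs` (lane g12) and `…Clause13LiaSymbolNegWindowDefs`: the BAND window of the model gluing (Mourre estimate,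
`model_band_estimate` p694551) needs `𝔖′(x) ≥ σ₀`; with `𝔖(x) = Φ(x²/4)`, `Φ = 1 − C − 2pE`, one has `Φ′(p) = 2C(p) − E(p)` (proved in
`…Clause13LiaSymbolDerivWindow`), and since `C`, `E` are antitone, on a `p`-cell `[a,b]` it suffices that `2·lowerC(b) − Eup(a) ≥ φ₀` with the bracket sums
of the `t`-grid of record.  Certificate (`φ₀ = 9/100` on `p ∈ [0.18, 3.3]`, i.e. `𝔖′(x) ≥ 9x/200` on `x ∈ [0.85, 3.63]`), soundness and the
real-variable statement are `…Clause13LiaSymbolDerivWindow`.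
Lane ns-filament-19175-p1 g16; `--supports stmt-NavierStokesRegularity-23612 --as helper`.
HONEST FRAMING: certified numerics for one explicit real integral, serving a HYPOTHETICAL filament-skeleton line on the NEGATIVE side of a MODEL route;
nothing here bears on Navier–Stokes regularity or blow-up.
-/

set_option linter.dupNamespace false

noncomputable section

namespace Summit.NavierStokesRegularity.NavierStokesRegularity.Theorems.AnalyticStripLiaSymbol

namespace Numerics

/-- One `p`-cell `[a, b]` of the band window: `Φ′ ≥ φ₀` via `φ₀ ≤ 2·lowerC(b) − Eup(a)` (`C`, `E` antitone). -/
def cellOKDer (φ₀ : ℚ) (l : List (ℚ × ℚ × ℚ)) (a b : ℚ) : Bool :=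
  decide (0 < a) && decide (a ≤ b) && decide (φ₀ ≤ 2 * lowerC b l - Eup a l)

/-- Check all consecutive cells of a `p`-grid. -/
def cellsOKDer (φ₀ : ℚ) (l : List (ℚ × ℚ × ℚ)) : List ℚ → Bool
  | a :: b :: rest => cellOKDer φ₀ l a b && cellsOKDer φ₀ l (b :: rest)
  | _ => true

/-- The `p`-grid tail after the head `18/100`: step `4·10⁻³` up to `0.5`, `10⁻²` up to `1.5`, `2·10⁻²` up to `3.3` (270 cells). -/
def pgridDerTail : List ℚ :=
  ((List.range 80).map fun j => ((184 : ℚ) + 4 * j) / 1000) ++ ((List.range 100).map fun j => ((51 : ℚ) + j) / 100)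
    ++ ((List.range 90).map fun j => ((152 : ℚ) + 2 * j) / 100)

end Numerics

end Summit.NavierStokesRegularity.NavierStokesRegularity.Theorems.AnalyticStripLiaSymbol

end
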